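import Summits.NavierStokesRegularity.NavierStokesRegularity.Theorems.StableStrataDoorAxiStability
import Summits.NavierStokesRegularity.NavierStokesRegularity.Theorems.StableStrataDoorSchema

/-!
# StableStrataDoorInstances — S26 «StableStrataDoor» (ε-STABLE STRATA: the open-neighbourhood principle K-stab(Φ,𝔖) and the
ε-AXISYMMETRIC Type-I door, uniform in the axis), part 5/6: instances of the schema: the axisymmetric stratum and the null stratum, door T-quiet PROVED (§9–§10)

§9 the axisymmetric stratum IS an instance (`axiPhi` = worst-angle `L¹(U)` defect, `axiStratum`; (H1)
`isWindowLsc_axiPhi`, (H2) `spreadsTo_axiPhi`, (H3) `stratumLiouville_axi` = KNSS; the schema door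
`stratumDoorAt_axiPhi : StratumDoorAt (axiPhi A U) ν M` + the bridge `physSmall_axiPhi` — the design's second proof
`targetEpsAxisym_of_schema` of the SAME statement `TargetEpsAxisym` is not restated: it is `StableStrataDoorAxiStability.targetEpsAxisym_holds`) and §10 the null stratum (`quietPhi`, `quietStratum`, `isWindowLsc_quietPhi`,
`spreadsTo_quietPhi`, `stratumLiouville_quiet`) with the door T-quiet `TargetQuietWindow` «no Type-I blow-up with an ε-quiet
similarity window» PROVED (`targetQuietWindow_holds`) — the trivial end of the atlas.

Door family of LADDER-NS N0 (local Type-I window doors S20–S26); THEOREMS-ONLY landing of the nsreg-p1 design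
`run/shared/lean/pub/ns-regularity-ideate/ns-regularity-ideate-p1/r25/Sketch26.lean` (ROUND-25.md; sha16 bf87a99673b3e6ef,
farm rc 0 / 0 sorry), split by section into `StableStrataDoor{Defs, WindowLimit, AxiStability, Schema, Instances, Uniform}`,
texts verbatim, namespace = file stem.  No route, no items (DIRECTOR-NS standing #32 (2); landing lane ns-door-S23-p1).
WHAT THIS IS NOT: not NS regularity (Clay (A)) and not a dent in `NoTypeII` (stmt-0056) — every statement lives INSIDE the
Type-I class; not the swirl hard cores (no Type-I-free statement); not the Type-I Liouville conjecture — only window-open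
neighbourhoods of strata where it is already a theorem; `ε` comes from compactness and is NOT explicit.
-/

noncomputable section

set_option linter.dupNamespace false

namespace Summit.NavierStokesRegularity.NavierStokesRegularity.Theorems.StableStrataDoorInstances

open MeasureTheory Set Function Filter Topology TopologicalSpace Metric
open scoped RealInnerProductSpace NNReal ENNReal Topology Pointwise
open Literature.Analysis Literature.Analysis.FluidPDE
open Summit.NavierStokesRegularity.NavierStokesRegularity.Theorems.PoloidalWindowDoorPoloidalWindowRigidityWindow
open Summit.NavierStokesRegularity.NavierStokesRegularity.Theorems.ZoomReturnDoorDefs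
open Summit.NavierStokesRegularity.NavierStokesRegularity.Theorems.ZoomReturnDoorWindowLimit
open Summit.NavierStokesRegularity.NavierStokesRegularity.Theorems.ZoomReturnDoorRemovableFactors
open Summit.NavierStokesRegularity.NavierStokesRegularity.Theorems.ZoomReturnDoorGlue
open Summit.NavierStokesRegularity.NavierStokesRegularity.Theorems.ZoomReturnDoorExtraction
open Summit.NavierStokesRegularity.NavierStokesRegularity.Theorems.ZoomReturnDoorClassicalLimit
open Summit.NavierStokesRegularity.NavierStokesRegularity.Theorems.StableStrataDoorDefs
open Summit.NavierStokesRegularity.NavierStokesRegularity.Theorems.StableStrataDoorWindowLimit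
open Summit.NavierStokesRegularity.NavierStokesRegularity.Theorems.StableStrataDoorAxiStability
open Summit.NavierStokesRegularity.NavierStokesRegularity.Theorems.StableStrataDoorSchema

/-! ## §9 The axisymmetric stratum IS an instance of the schema (second, schema-level proof of the door T-axi) -/

/-- the observable: worst-angle `L¹(U)` axisymmetry defect about `A e₃`. -/
def axiPhi (A : EuclideanSpace ℝ (Fin 3) ≃ₗᵢ[ℝ] EuclideanSpace ℝ (Fin 3)) (U : Set (EuclideanSpace ℝ (Fin 3)))
    (F : EuclideanSpace ℝ (Fin 3) → EuclideanSpace ℝ (Fin 3)) : ℝ≥0∞ :=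
  ⨆ θ : ℝ, ∫⁻ ζ in U, ENNReal.ofReal (axiDefect A F θ ζ)

/-- the stratum: slice fields axisymmetric about `A e₃`. -/
def axiStratum (A : EuclideanSpace ℝ (Fin 3) ≃ₗᵢ[ℝ] EuclideanSpace ℝ (Fin 3)) :
    Set (EuclideanSpace ℝ (Fin 3) → EuclideanSpace ℝ (Fin 3)) :=
  {F | IsAxisymmetric (fun x => A.symm (F (A x)))}

/-- **(H1) for the axisymmetry defect** (Fatou, angle by angle). -/
theorem isWindowLsc_axiPhi (A : EuclideanSpace ℝ (Fin 3) ≃ₗᵢ[ℝ] EuclideanSpace ℝ (Fin 3)) (U : Set (EuclideanSpace ℝ (Fin 3))) :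
    IsWindowLsc (axiPhi A U) := by
  intro Fn F hFn hF hpt
  refine iSup_le fun θ => ?_
  have hmeas : ∀ n, Measurable fun ζ => ENNReal.ofReal (axiDefect A (Fn n) θ ζ) :=
    fun n => (ENNReal.continuous_ofReal.comp (continuous_axiDefect A (hFn n) θ)).measurable
  have hptw : ∀ ζ, Tendsto (fun n => ENNReal.ofReal (axiDefect A (Fn n) θ ζ)) atTop
      (𝓝 (ENNReal.ofReal (axiDefect A F θ ζ))) :=
    fun ζ => ENNReal.tendsto_ofReal (tendsto_axiDefect A θ ζ (hpt (A ζ)) (hpt (A (rotZ θ ζ))))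
  have hFatou : ∫⁻ ζ in U, liminf (fun n => ENNReal.ofReal (axiDefect A (Fn n) θ ζ)) atTop ≤
      liminf (fun n => ∫⁻ ζ in U, ENNReal.ofReal (axiDefect A (Fn n) θ ζ)) atTop :=
    lintegral_liminf_le' fun n => (hmeas n).aemeasurable
  have hlim : (fun ζ => liminf (fun n => ENNReal.ofReal (axiDefect A (Fn n) θ ζ)) atTop) =
      fun ζ => ENNReal.ofReal (axiDefect A F θ ζ) := funext fun ζ => (hptw ζ).liminf_eq
  rw [hlim] at hFatou
  refine hFatou.trans (liminf_le_liminf (Eventually.of_forall fun n => ?_))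
  exact le_iSup (fun θ' : ℝ => ∫⁻ ζ in U, ENNReal.ofReal (axiDefect A (Fn n) θ' ζ)) θ

/-- zero integral of the (continuous, nonnegative) defect over an open window ⇒ zero defect on the window. -/
theorem axiDefect_eq_zero_of_lintegral (A : EuclideanSpace ℝ (Fin 3) ≃ₗᵢ[ℝ] EuclideanSpace ℝ (Fin 3))
    {F : EuclideanSpace ℝ (Fin 3) → EuclideanSpace ℝ (Fin 3)} (hF : Continuous F) {U : Set (EuclideanSpace ℝ (Fin 3))}
    (hU : IsOpen U) (θ : ℝ) (hint : ∫⁻ ζ in U, ENNReal.ofReal (axiDefect A F θ ζ) = 0) :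
    ∀ ζ ∈ U, axiDefect A F θ ζ = 0 := by
  have hgc : Continuous fun ζ => axiDefect A F θ ζ := continuous_axiDefect A hF θ
  have hgm : Measurable fun ζ => ENNReal.ofReal (axiDefect A F θ ζ) := (ENNReal.continuous_ofReal.comp hgc).measurable
  have hae : (fun ζ => ENNReal.ofReal (axiDefect A F θ ζ)) =ᵐ[volume.restrict U] 0 := (lintegral_eq_zero_iff hgm).1 hint
  have heq : EqOn (fun ζ => ENNReal.ofReal (axiDefect A F θ ζ)) 0 U :=
    Measure.eqOn_open_of_ae_eq hae hU (ENNReal.continuous_ofReal.comp hgc).continuousOn continuousOn_const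
  intro ζ hζ
  have h := heq hζ
  simp only [Pi.zero_apply, ENNReal.ofReal_eq_zero] at h
  exact le_antisymm h (norm_nonneg _)

/-- **(H2) for the axisymmetry defect** (analytic spread, `isAxisymmetric_conj_of_window`). -/
theorem spreadsTo_axiPhi {ν : ℝ} (hν : 0 < ν) (A : EuclideanSpace ℝ (Fin 3) ≃ₗᵢ[ℝ] EuclideanSpace ℝ (Fin 3))
    {U : Set (EuclideanSpace ℝ (Fin 3))} (hU : IsOpen U) (hUne : U.Nonempty) :
    SpreadsTo (axiPhi A U) (axiStratum A) ν := by
  intro v s hs han hzero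
  have hθ : ∀ θ : ℝ, ∫⁻ ζ in U, ENNReal.ofReal (axiDefect A (profileWindowField ν v s) θ ζ) = 0 :=
    fun θ => ENNReal.iSup_eq_zero.1 hzero θ
  have hc : Continuous (profileWindowField ν v s) := continuous_profileWindowField (han.continuous)
  exact isAxisymmetric_conj_of_window hν hs han A hU hUne
    (fun θ ζ hζ => axiDefect_eq_zero_of_lintegral A hc hU θ (hθ θ) ζ hζ)

/-- **(H3) for the axisymmetric stratum = the tree's KNSS Type-I Liouville theorem (any axis, swirl allowed).** -/
theorem stratumLiouville_axi (A : EuclideanSpace ℝ (Fin 3) ≃ₗᵢ[ℝ] EuclideanSpace ℝ (Fin 3)) (D : ℝ) :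
    StratumLiouville (axiStratum A) D := by
  intro V q hVcl hVdec hstrat τ hτ x
  have hVmild : IsAncientMildSolution 1 V :=
    (Summit.NavierStokesRegularity.NavierStokesRegularity.Theorems.PolyhedralDssProfileExists.Birth.isTypeIAncientMild_of_classical_typeI
      hVcl hVdec).isAncientMildSolution
  have hVslice : ∀ τ < 0, Continuous (V τ) := fun τ hτ => (hVcl.contDiff_velocity (by exact hτ)).continuous
  have hVmeas : ∀ τ < 0, AEStronglyMeasurable (V τ) volume := fun τ hτ => (hVslice τ hτ).aestronglyMeasurable
  have hae := hVmild.ae_eq_zero_of_isAxisymmetric_conj_of_hasTypeIDecay hVmeas A hstrat hVdec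
  have hV0 : V τ = 0 := ((hVslice τ hτ).ae_eq_iff_eq volume continuous_const).1 (hae τ hτ)
  simpa using congrFun hV0 x

/-- the physical-side schema hypothesis for the observable `axiPhi A U` from the eventual `ε`-smallness of the defect
(the schema's `PhysSmall (axiPhi A U) T x₀ u ε` is implied by `AxiDefectEventuallySmall T x₀ u A U ε`, angle by angle). -/
theorem physSmall_axiPhi {T : ℝ} {x₀ : EuclideanSpace ℝ (Fin 3)} {u : ℝ → EuclideanSpace ℝ (Fin 3) → EuclideanSpace ℝ (Fin 3)}
    {A : EuclideanSpace ℝ (Fin 3) ≃ₗᵢ[ℝ] EuclideanSpace ℝ (Fin 3)} {U : Set (EuclideanSpace ℝ (Fin 3))} {ε : ℝ}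
    (hsmall : AxiDefectEventuallySmall T x₀ u A U ε) : PhysSmall (axiPhi A U) T x₀ u ε :=
  hsmall.mono fun _ ht => iSup_le ht

/-- **The axisymmetric stratum THROUGH THE SCHEMA** (second, schema-level road to the door T-axi): for every axis `A e₃`
and every open nonempty window `U`, the schema's `ε`-door `StratumDoorAt (axiPhi A U) ν M` holds at every `M`, by
`stratumDoorAt_of_liouville` fed with (H1) `isWindowLsc_axiPhi`, (H2) `spreadsTo_axiPhi`, (H3) `stratumLiouville_axi`.
With `physSmall_axiPhi` this is the door `TargetEpsAxisym` again — already the tree theorem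
`StableStrataDoorAxiStability.targetEpsAxisym_holds`, so it is not restated here (the design file's
`targetEpsAxisym_of_schema`). -/
theorem stratumDoorAt_axiPhi {ν : ℝ} (hν : 0 < ν) (A : EuclideanSpace ℝ (Fin 3) ≃ₗᵢ[ℝ] EuclideanSpace ℝ (Fin 3))
    {U : Set (EuclideanSpace ℝ (Fin 3))} (hU : IsOpen U) (hne : U.Nonempty) (M : ℝ) :
    StratumDoorAt (axiPhi A U) ν M :=
  stratumDoorAt_of_liouville (𝔖 := axiStratum A) hν (isWindowLsc_axiPhi A U) (spreadsTo_axiPhi hν A hU hne)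
    (fun D _ => stratumLiouville_axi A D) M

/-! ## §10 The two ends of the atlas as instances: the NULL stratum (door T-quiet «no Type-I blow-up with an ε-quiet
similarity window», PROVED) — every translation-invariant / helical stratum degenerates to it under Type-I decay — and,
at the other end, the axisymmetric stratum of §9 (KNSS). -/

/-- the observable of the null stratum: the `L¹(U)` mass of the window field. -/
def quietPhi (U : Set (EuclideanSpace ℝ (Fin 3))) (F : EuclideanSpace ℝ (Fin 3) → EuclideanSpace ℝ (Fin 3)) : ℝ≥0∞ :=
  ∫⁻ ζ in U, ENNReal.ofReal ‖F ζ‖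

/-- the null stratum. -/
def quietStratum : Set (EuclideanSpace ℝ (Fin 3) → EuclideanSpace ℝ (Fin 3)) := {F | ∀ x, F x = 0}

/-- **(H1) for the null stratum**: the `L¹(U)` mass is lower semicontinuous along pointwise limits (Fatou). -/
theorem isWindowLsc_quietPhi (U : Set (EuclideanSpace ℝ (Fin 3))) : IsWindowLsc (quietPhi U) := by
  intro Fn F hFn hF hpt
  have hmeas : ∀ n, Measurable fun ζ => ENNReal.ofReal ‖Fn n ζ‖ :=
    fun n => (ENNReal.continuous_ofReal.comp (hFn n).norm).measurable
  have hptw : ∀ ζ, Tendsto (fun n => ENNReal.ofReal ‖Fn n ζ‖) atTop (𝓝 (ENNReal.ofReal ‖F ζ‖)) :=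
    fun ζ => ENNReal.tendsto_ofReal (hpt ζ).norm
  have hFatou : ∫⁻ ζ in U, liminf (fun n => ENNReal.ofReal ‖Fn n ζ‖) atTop ≤
      liminf (fun n => ∫⁻ ζ in U, ENNReal.ofReal ‖Fn n ζ‖) atTop :=
    lintegral_liminf_le' fun n => (hmeas n).aemeasurable
  have hlim : (fun ζ => liminf (fun n => ENNReal.ofReal ‖Fn n ζ‖) atTop) = fun ζ => ENNReal.ofReal ‖F ζ‖ :=
    funext fun ζ => (hptw ζ).liminf_eq
  rw [hlim] at hFatou
  exact hFatou

/-- **(H2) for the null stratum**: zero `L¹(U)` mass of the window field of an analytic slice ⇒ the slice vanishes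
(continuity on the open window + identity theorem; the window scale `σ > 0` is undone by dilation). -/
theorem spreadsTo_quietPhi {ν : ℝ} (hν : 0 < ν) {U : Set (EuclideanSpace ℝ (Fin 3))} (hU : IsOpen U) (hUne : U.Nonempty) :
    SpreadsTo (quietPhi U) quietStratum ν := by
  intro v s hs han hzero
  have hns : 0 < -s := neg_pos.2 hs
  set σ : ℝ := Real.sqrt (-s) / Real.sqrt ν with hσ
  have hσpos : 0 < σ := div_pos (Real.sqrt_pos.2 hns) (Real.sqrt_pos.2 hν)
  have hσν : σ * ν ≠ 0 := mul_ne_zero hσpos.ne' hν.ne'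
  -- zero `L¹(U)` mass + continuity ⇒ the window field vanishes on `U`
  have hc : Continuous (profileWindowField ν v s) := continuous_profileWindowField han.continuous
  have hgm : Measurable fun ζ => ENNReal.ofReal ‖profileWindowField ν v s ζ‖ :=
    (ENNReal.continuous_ofReal.comp hc.norm).measurable
  have hae : (fun ζ => ENNReal.ofReal ‖profileWindowField ν v s ζ‖) =ᵐ[volume.restrict U] 0 :=
    (lintegral_eq_zero_iff hgm).1 hzero
  have heq : EqOn (fun ζ => ENNReal.ofReal ‖profileWindowField ν v s ζ‖) 0 U :=
    Measure.eqOn_open_of_ae_eq hae hU (ENNReal.continuous_ofReal.comp hc.norm).continuousOn continuousOn_const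
  have hU0 : ∀ ζ ∈ U, v s (σ • ζ) = 0 := by
    intro ζ hζ
    have h := heq hζ
    simp only [Pi.zero_apply, ENNReal.ofReal_eq_zero] at h
    have h0 : profileWindowField ν v s ζ = 0 := norm_eq_zero.1 (le_antisymm h (norm_nonneg _))
    simp only [profileWindowField] at h0
    rw [← hσ] at h0
    exact (smul_eq_zero.1 h0).resolve_left hσν
  -- analytic spread of `g = v(s) ∘ (σ • ·)`
  set g : EuclideanSpace ℝ (Fin 3) → EuclideanSpace ℝ (Fin 3) := fun ζ => v s (σ • ζ) with hg
  have hgan : AnalyticOnNhd ℝ g univ :=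
    han.comp (fun w _ => analyticAt_id.const_smul (c := σ)) fun _ _ => mem_univ _
  obtain ⟨ζ₀, hζ₀⟩ := hUne
  have hev : g =ᶠ[𝓝 ζ₀] 0 := by
    filter_upwards [hU.mem_nhds hζ₀] with ζ hζ
    exact hU0 ζ hζ
  have hgz : EqOn g 0 univ :=
    hgan.eqOn_zero_of_preconnected_of_eventuallyEq_zero isPreconnected_univ (mem_univ ζ₀) hev
  intro x
  have h := hgz (mem_univ (σ⁻¹ • x))
  simp only [hg, smul_smul, mul_inv_cancel₀ hσpos.ne', one_smul, Pi.zero_apply] at h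
  exact h

/-- **(H3) for the null stratum** is trivial: a solution all of whose slices vanish vanishes. -/
theorem stratumLiouville_quiet (D : ℝ) : StratumLiouville quietStratum D :=
  fun _ _ _ _ hstrat τ hτ x => hstrat τ hτ x

/-- target (rank 0) · DOOR T-quiet «no Type-I blow-up with an ε-QUIET similarity window»: for every bounded open
window `U ≠ ∅` of similarity coordinates (it may sit far from the axis of blow-up) some `ε(ν, M, U) > 0` makes
«space–time local Type I (M) at `(x₀,T)` + `∫_U √(T−t)|u(t, x₀ + √(T−t)ζ)| dζ ≤ ε` for all `t` near `T`» impossible at a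
singular point.  The trivial-stratum end of the atlas (unique continuation made quantitative by compactness). -/
def TargetQuietWindow : Prop :=
  ∀ (ν M : ℝ), 0 < ν → ∀ (U : Set (EuclideanSpace ℝ (Fin 3))), IsOpen U → U.Nonempty → Bornology.IsBounded U →
    ∃ ε : ℝ, 0 < ε ∧ ∀ (T : ℝ), 0 < T →
      ∀ (u : ℝ → EuclideanSpace ℝ (Fin 3) → EuclideanSpace ℝ (Fin 3)) (p : ℝ → EuclideanSpace ℝ (Fin 3) → ℝ),
      IsClassicalNSSolutionOn (Set.Ico 0 T) ν 0 u p → IsLerayHopfOn T ν 0 (u 0) u → HasRapidSpatialDecay (u 0) →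
      ∀ (x₀ : EuclideanSpace ℝ (Fin 3)) (ρ : ℝ), 0 < ρ →
      (∀ t ∈ Set.Ico 0 T, T - ρ ^ 2 < t → ∀ x ∈ Metric.ball x₀ ρ, ‖u t x‖ * (‖x - x₀‖ + Real.sqrt (ν * (T - t))) ≤ M) →
      (∀ᶠ t in nhdsWithin T (Set.Iio T), ∫⁻ ζ in U, ENNReal.ofReal ‖physWindowField T x₀ u t ζ‖ ≤ ENNReal.ofReal ε) →
      IsBackwardBoundedAt u T x₀

/-- **DOOR T-quiet HOLDS** (schema with the null stratum). -/
theorem targetQuietWindow_holds : TargetQuietWindow := by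
  intro ν M hν U hU hne hbdd
  obtain ⟨ε, hε, hdoor⟩ := stratumDoorAt_of_liouville (𝔖 := quietStratum) hν (isWindowLsc_quietPhi U)
    (spreadsTo_quietPhi hν hU hne) (fun D _ => stratumLiouville_quiet D) M
  exact ⟨ε, hε, fun T hT u p hcl hLH hdec x₀ ρ hρ hM hsmall => hdoor T hT u p hcl hLH hdec x₀ ρ hρ hM hsmall⟩

end Summit.NavierStokesRegularity.NavierStokesRegularity.Theorems.StableStrataDoorInstances
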